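import Summits.BirchSwinnertonDyer.Rank1Residual.Additive.X4RankZeroVisibleLowerBoundTransport
import Summits.BirchSwinnertonDyer.Rank1Residual.GaloisImage.LocalTorsionAwayFromPAdicCompletion
import Summits.BirchSwinnertonDyer.Rank1Residual.GaloisImage.VisibleWitnessHybridPlaces
import Summits.BirchSwinnertonDyer.Rank1Residual.Additive.X4ThreeKuriharaCertRecordsS2_6
import Summits.BirchSwinnertonDyer.Rank1Residual.Additive.IntModelTamagawaCertificateLocal
import Summits.BirchSwinnertonDyer.Rank1Residual.Additive.JValuationOfIntModel
import Summits.BirchSwinnertonDyer.Rank1Residual.X11b.VisibilityPrimeList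
import HarnessLib

/-!
# T-VIS3-TATE ROW SHAPE (transport currency): `BSD(E,3)` for `6408a1` from its `3`-CONGRUENT rank-2 partner
# `6408b1`, BOTH additive potentially multiplicative at `3` — per place `ι_v(θ) = 1` by the kind of the place, every
# local binder IN THE KERNEL (cell `b2b-bsdres`, team n1011, ROW T-VIS3-TATE-REC FILE 3 consumer; route planner 1
# ROUTE-1 §42 ST-42a road PASS-T; seat p14 lineage; generated by `tate/vis3t_transport.py`; filed one at a time per
# lead R5-96 'next per your (c)/(d) plan one at a time' after FILE 3 p317613)

HONEST FRAMING (cell `b2b-bsdres`, run/shared/lean/b2b/bsd-rank1-residual/, verbatim in every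
file): the goal of the cell is to DELETE the COMBINATION-SHAPED residual classes of the
Birch–Swinnerton-Dyer formula for ALL analytic-rank `≤ 1` elliptic curves over `ℚ` — "full BSD
formula for every rank `≤ 1` curve in class `C`" assembled STRICTLY from published theorems — so
that the rank-`≤ 1` remainder becomes exactly the CONSTRUCTION-SHAPED classes, which are TYPED
(missing-input `Prop`s), NOT attempted. This is not "finishing BSD". Team n1011 (N11 = X4 ∧ `p = 3`),
research route; a ROW SHAPE closes NO class and moves no mark / label / count; nothing booked;
theorems only (no definition, no named fact, no `sorry`).  Ruling of record R5-82 (d) / R5-87 (n) / R5-89 (b): evidence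
columns (θ, rank E′, r_an, #Ш_an) displayed as binders; closes nothing beyond them.

## What

**`bsdp3_visT_v6408a1`** — the N11 row `6408a1 = [0, 0, 0, -21639, -1225190]` (`N = 6408`; X4 at `3`, (M): `ord₃ j = -4`; `r_an = 0`,
`ord₃ #Ш_an = 2`) with the `3`-congruent partner `6408b1 = [0, 0, 0, -12, 340]` of rank `2` (r1 `g29_cvis_pairs.tsv`
verdict `FAIL@3(t3=3,E3=add-pm/add-pm)`; ROUTE-1 §42 ST-42a kind (iii′) at `3`: both additive potentially multiplicative, same twist class
`γ(E)/γ(E′) = -7213/14414`, `μ₃(ℚ₃) = 1`); places over `[2, 3, 89]`: `2`: kind (i); `89`: kind (iii); NO paid place; over the transport-currency socket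
`X4RankZero.bsdp_three_potMult_of_congr_of_transport_of_primeList` (n1011-p14 T-VIS3-TATE-REC FILE 3).  KERNEL: `E′` globally
minimal (bounded Kraus), `|Δ(E)| = 2⁸·3¹⁰·89¹`, `|Δ(E′)| = 2⁸·3⁷·89¹`, E-side `Additive.X4ThreeKuriharaCert.surj3_v6408a1` BY NAME, place `3` by the numerals lemma
`kindIIIPrime_numerals_6408a1_6408b1_at3` (p09's recipe) + p09's `TwistedKummer.relIndex_map_selmerLocalKer_eq_one_of_one_lt_valuation_j`, kind-(i) places by
local certificates + the Literature's `relIndex_map_selmerLocalKer_eq_one_of_card_torsion_eq_one`, kind-(iii) places by p17's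
D9 `DivisionDecider.relIndex_eq_one_of_kindIII_checks_of_intModel` (numerals `decide`).  BINDERS LEFT = {the seven facts of the
(M)-END, A41 `hU2`} ∪ {`hr`, `hq`/`hv`} ∪ {`θ`/`hθ`, `hrank`} — EVIDENCE columns, not booked.  NO port, NO tower.

References: [CremonaMazur2000] §3; [AgasheStein2002] Thm. 3.1; [Delbourgo1998] Prop. 4; [Kato2004Asterisque] Thm. 14.5;
[SilvermanAEC2009] VII.5.1, X.4.2, X.4.14; [SilvermanATAEC1994] IV.9.4, V.5.2–5.4; [MilneADT2006] I.3.3; [Cremona2006].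
-/

set_option autoImplicit false

noncomputable section

open scoped Classical NumberField
open IsDedekindDomain NumberField WeierstrassCurve Rat.HeightOneSpectrum
  Literature.NumberTheory.EllipticCurves Literature.NumberTheory.EllipticCurves.ModularForms
  Literature.NumberTheory.EllipticCurves.Rank1Residual
  Literature.NumberTheory.EllipticCurves.Rank1Residual.Typed
  Literature.NumberTheory.GaloisRepresentations
  Summit.BirchSwinnertonDyer.BirchSwinnertonDyer.Rank1Residual.IntModel
  Summit.BirchSwinnertonDyer.BirchSwinnertonDyer.Rank1Residual.X11RankOne
  Summit.BirchSwinnertonDyer.BirchSwinnertonDyer.Rank2Observatory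
  Summit.BirchSwinnertonDyer.BirchSwinnertonDyer.Rank2Observatory.Tam
  Summit.BirchSwinnertonDyer.Rank1Residual.GaloisImage

namespace Summit.BirchSwinnertonDyer.Rank1Residual.Additive

/-- **KIND (iii′) NUMERALS for `6408a1 ~ 6408b1` at the place of `3`, decided** (p09's recipe
`TwistedKummer.kindIIIPrime_numerals_three_of_certs`): `j(E) = 6004374601552/7209`, `j(E′) = -1024/267`, `γ(E) = -7213/7351140`, `γ(E′) = 1/510`,
ratio `-7213/14414` (`3^0 ∥ -7213·14414`, square flag true), `μ₃(ℚ₃) = 1`. [cite: SilvermanATAEC1994, Ch. V Lemma 5.2 (c), Thm. 5.3, Cor. 5.4] -/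
theorem kindIIIPrime_numerals_6408a1_6408b1_at3 (W W' : WeierstrassCurve ℚ) [W.IsElliptic] [W'.IsElliptic]
    (hW : W = ⟨0, 0, 0, -21639, -1225190⟩) (hW' : W' = ⟨0, 0, 0, -12, 340⟩)
    {v : HeightOneSpectrum (𝓞 ℚ)} (hv : (primesEquiv v : ℕ) = 3) :
    1 < v.valuation ℚ W.j ∧ 1 < v.valuation ℚ W'.j ∧
      (∃ r : v.adicCompletion ℚ, algebraMap ℚ (v.adicCompletion ℚ) (-(W.c₄ / W.c₆)) =
        r ^ 2 * algebraMap ℚ (v.adicCompletion ℚ) (-(W'.c₄ / W'.c₆))) ∧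
      (∀ ζ : v.adicCompletion ℚ, ζ ^ 3 = 1 → ζ = 1) := by
  haveI : Fact (Nat.Prime 3) := ⟨Nat.prime_three⟩
  have hj : W.j = 6004374601552 / 7209 := by
    rw [WeierstrassCurve.j_eq_c₄_pow_three_div_Δ]; subst hW
    norm_num [WeierstrassCurve.c₄, WeierstrassCurve.Δ, WeierstrassCurve.b₂, WeierstrassCurve.b₄,
      WeierstrassCurve.b₆, WeierstrassCurve.b₈]
  have hj' : W'.j = -1024 / 267 := by
    rw [WeierstrassCurve.j_eq_c₄_pow_three_div_Δ]; subst hW'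
    norm_num [WeierstrassCurve.c₄, WeierstrassCurve.Δ, WeierstrassCurve.b₂, WeierstrassCurve.b₄,
      WeierstrassCurve.b₆, WeierstrassCurve.b₈]
  have hA : -(W.c₄ / W.c₆) = -7213 / 7351140 := by
    subst hW
    norm_num [WeierstrassCurve.c₄, WeierstrassCurve.c₆, WeierstrassCurve.b₂, WeierstrassCurve.b₄,
      WeierstrassCurve.b₆]
  have hB : -(W'.c₄ / W'.c₆) = 1 / 510 := by
    subst hW'
    norm_num [WeierstrassCurve.c₄, WeierstrassCurve.c₆, WeierstrassCurve.b₂, WeierstrassCurve.b₄,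
      WeierstrassCurve.b₆]
  exact TwistedKummer.kindIIIPrime_numerals_three_of_certs v hv W W' hj (by norm_num) (by decide +kernel) hj'
    (by norm_num) (by decide +kernel) hA hB (by norm_num) (N := -7213) (D := 14414) (by norm_num)
    (by norm_num) (w := 0) (by norm_num) (by norm_num) (by decide +kernel) (w₃ := 1) (by norm_num)
    (by norm_num) (by decide +kernel)

/-- The local Tamagawa certificate of the partner `6408b1` at `2` (`TamLocal` = `⟨2, 1, 5, 0, 2, 0, 2, 8, 71, 0, 4⟩`) passes the kernel check.
[cite: SilvermanATAEC1994, IV.9.4] -/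
theorem tamLocal_check_6408b1_2 :
    TamLocal.check ⟨2, 1, 5, 0, 2, 0, 2, 8, 71, 0, 4⟩ ⟨0, 0, 0, -12, 340⟩ = true := by
  decide +kernel

/-- **T-VIS3-TATE ROW SHAPE, transport currency (CLOSES NOTHING, moves no mark): `BSD(E,3)` for `6408a1` from its
`3`-congruent rank-2 partner `6408b1`** — kind (iii′) at `3`, the other places of kinds {(i), (iii)} as listed, every local
binder in the kernel. [cite: CremonaMazur2000, §3 and Table 1] [cite: SilvermanATAEC1994, Ch. V Lemma 5.2 (c), Thm. 5.3, Cor. 5.4]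
[cite: SilvermanAEC2009, Thm. X.4.2 (a) and X.4.14] [cite: Cremona2006, Table 1 (labels 6408a1, 6408b1)] -/
theorem bsdp3_visT_v6408a1
    (hKatoS : Kato2004.rankZero_padicValNat_sha_le_sub_localTamagawa_of_additive_potGood_of_imageContainsSL2)
    (hDel : Delbourgo1998.prop4_rankZero_pow_dvd_constantCoeff)
    (hGZK : rank_eq_analyticRank_of_analyticRank_le_one) (hmod : hasEntireLFunction_rat)
    (hmodD : nonempty_modularParametrizationData)
    (hKatoχ : Wuthrich2014.kato_halfEigenCharIdeal_dvd_cyclotomicPrime_of_surjective)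
    (hCT : exists_casselsTate_pairing (K := ℚ))
    (hU2 : Silverman1994_thmV53_corV54_tateUniformisation.{0})
    (W : WeierstrassCurve ℚ) [W.IsElliptic] [W.IsGloballyMinimal]
    (hI : integralModelInt W = ⟨0, 0, 0, -21639, -1225190⟩)
    (hr : W.analyticRank = 0)
    {q : ℚ} (hq : shaAn W = (q : ℂ)) (hv : padicValRat 3 q ≤ 2)
    (W' : WeierstrassCurve ℚ) (hW' : W' = ⟨0, 0, 0, -12, 340⟩) [W'.IsElliptic]
    (θ : geomTorsion W' ((3 : ℕ) : ℤ) ≃+ geomTorsion W ((3 : ℕ) : ℤ))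
    (hθ : ∀ (σ : Field.absoluteGaloisGroup ℚ) (P : geomTorsion W' ((3 : ℕ) : ℤ)),
      θ (σ • P) = σ • θ P)
    (hrank : 2 ≤ W'.mordellWeilRank) :
    haveI : Fact (Nat.Prime 3) := ⟨Nat.prime_three⟩
    BSDp W 3 := by
  haveI : Fact (Nat.Prime 3) := ⟨Nat.prime_three⟩
  haveI : Fact (Nat.Prime 2) := ⟨by norm_num⟩
  haveI : Fact (Nat.Prime 89) := ⟨by norm_num⟩
  -- the row `6408a1`
  have hsurj : W.HasSurjectiveModNGaloisRep 3 := Additive.X4ThreeKuriharaCert.surj3_v6408a1 hI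
  have hX : ClassX4 W 3 :=
    ⟨by norm_num, addv_of_intModel hI 3 (by decide) (by decide),
      hasIrreducibleModPGaloisRep_of_hasSurjectiveModNGaloisRep W 3 hsurj⟩
  have hj : padicValRat 3 W.j < 0 :=
    padicValRat_j_neg_of_intModel hI (p := 3) 2 (by decide) (by decide)
  have hE : (⟨0, 0, 0, -21639, -1225190⟩ : WeierstrassCurve ℤ).map (Int.castRingHom ℚ) = W := by
    rw [IntModelTam.eq_baseChange_of_integralModelInt hI]; rfl
  have hW : W = ⟨0, 0, 0, -21639, -1225190⟩ := by
    rw [← hE]; exact map_mk_int 0 0 0 (-21639) (-1225190)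
  -- the partner `6408b1`: globally minimal, integral model
  have hM' : W'.IsGloballyMinimal := by
    rw [hW']
    exact isGloballyMinimal_of_krausCriterion_bounded 0 0 0 (-12) 340
      (by decide +kernel) (by decide +kernel) (by decide +kernel)
  have hI' : integralModelInt W' = ⟨0, 0, 0, -12, 340⟩ := by
    subst hW'; exact integralModelInt_eq_of_map_eq _ (map_mk_int 0 0 0 (-12) 340)
  have hF : (⟨0, 0, 0, -12, 340⟩ : WeierstrassCurve ℤ).map (Int.castRingHom ℚ) = W' := by
    rw [hW']; exact map_mk_int 0 0 0 (-12) 340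
  refine X4RankZero.bsdp_three_potMult_of_congr_of_transport_of_primeList hKatoS hDel hGZK hmod hmodD
    hKatoχ hCT W hr hX hsurj hj hq hv W' θ hθ (le_trans one_le_two hrank) hE hF [2, 3, 89] (by decide)
    (X11b.forall_mem_of_natAbs_eq_prod_pow [2, 3, 89] [8, 10, 1] (by intro q hq; simp only [List.mem_cons, List.mem_nil_iff, or_false] at hq; rcases hq with rfl | rfl | rfl <;> norm_num) (by decide +kernel))
    (X11b.forall_mem_of_natAbs_eq_prod_pow [2, 3, 89] [8, 7, 1] (by intro q hq; simp only [List.mem_cons, List.mem_nil_iff, or_false] at hq; rcases hq with rfl | rfl | rfl <;> norm_num) (by decide +kernel))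
    (fun v hvL ↦ ?_)
  simp only [List.mem_cons, List.mem_nil_iff, or_false] at hvL
  rcases hvL with h2 | h3 | h89
  · -- `v = 2`: kind (i) — the partner is additive Kodaira In*, value set [2, 4]; `ι_v(θ) = 1` from `E′(ℚ_v)[3] = 0`
    exact relIndex_map_selmerLocalKer_eq_one_of_card_torsion_eq_one W W' θ hθ
      (fun hmem ↦ by
        have h3' := Rat.HeightOneSpectrum.primesEquiv_eq_of_natCast_mem v Nat.prime_three hmem
        omega)
      (LocalTorsionAway.natCard_ker_nsmul_adicCompletion_eq_one_of_intModel_of_additive_tamLocal_forall hI' 2 3 (by norm_num) h2 (by decide) (by decide) (E := ⟨2, 1, 5, 0, 2, 0, 2, 8, 71, 0, 4⟩) rfl tamLocal_check_6408b1_2 (by decide))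
  · -- `v = 3`: kind (iii′) — the numerals lemma above, fed to p09's transport lemma
    obtain ⟨h₁, h₂, h₃, h₄⟩ := kindIIIPrime_numerals_6408a1_6408b1_at3 W W' hW hW' h3
    exact TwistedKummer.relIndex_map_selmerLocalKer_eq_one_of_one_lt_valuation_j W v hU2 (by norm_num) W' θ hθ
      h₁ h₂ h₃ h₄
  · -- `v = 89`: kind (iii) — both curves multiplicative at `89` (`89¹ ∥ Δ`, `89¹ ∥ Δ′`), same twist class (`89^0 ∥ -7213·14414`, square flag), `μ₃(ℚ_89) = 1`; p17 D9
    exact DivisionDecider.relIndex_eq_one_of_kindIII_checks_of_intModel 89 hU2 W W' hI hI' θ hθ h89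
      (by decide) (by decide) (by decide) (by decide) (by decide) (by decide) (N := -7213) (D := 14414) (by decide)
      (by norm_num [WeierstrassCurve.c₄, WeierstrassCurve.c₆, WeierstrassCurve.b₂, WeierstrassCurve.b₄,
        WeierstrassCurve.b₆])
      (w := 0) (by decide) (by decide) (by decide +kernel) (w₃ := 0) (by decide) (by decide) (by decide +kernel)

end Summit.BirchSwinnertonDyer.Rank1Residual.Additive

end
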